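import Literature.MathematicalPhysics.QuantumLattice.SourcedTorusRegionEnergyBound
import Literature.MathematicalPhysics.QuantumLattice.DWaveSourceTorusRegionEnergyBound
import HarnessLib

/-!
# Barrier: the SITE-LOCAL ε-lift — inside the class of translation-invariant finite-range lattice fermion
# models the minimal flag-sector energy is `N · min(e_L(h) + ε, e_L(0))`, attained in the uniform sectors

Barrier catalogue `Literature/Barriers/HubbardSuperconductivity/` (D-0021), entry `SourcedResponseEpsilonLiftLocal`;
the translation-invariant, finite-range companion of `SourcedResponseEpsilonLift.lean` (the ε-lift with ONE global
inert level, `H ⊕ (E₀(H) − ε)`; cell `hubbard-cq`, lens `negation-1`, census (13)).  That entry left open the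
evasion "my inequality uses locality / finite range / translation invariance of the Hamiltonian": the global lift
is block-diagonal with one global inert state.  The present entry closes it (memo NEGATION-SIZING-v2 §10, S0-LOCAL).

**The construction (negation-1, §10).**  `Λ = (ℤ/Lℤ)²`, `H_Λ(h)` a translation-invariant finite-range pair-sourced
Hubbard Hamiltonian (hoppings `κ`, pair weights `h·ω`, e.g. the `t–t'–U` model with the `d`-wave source),
`e_L(h) = E₀(H_Λ(h))/N`.  Adjoin one conserved classical flag per site (`P^A_x + P^B_x = 1`) and set
`H̃(h) = Σ_X Φ_X(h) Π_{x∈X} P^A_x + Σ_x P^B_x (e_L(0) + K n_x) + ε Σ_x P^A_x + J·(flag domain walls)`: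
translation-invariant, finite range, fermion-parity even, `U(1)`-covariant like `H_Λ(h)`.  `H̃` is block-diagonal
over the `2^N` flag configurations; in the sector with active set `A ⊆ Λ` its fermionic part is
`H_A(h) + K N_{Λ∖A}` (the terms of `H_Λ(h)` INSIDE `A`, `= tiSourcedOn L κ ω U μ h A` of
`SourcedTorusRegionEnergyBound.lean`, plus a non-negative number penalty on the inert sites) and its constant part
is `ε|A| + e_L(0)|Λ∖A| + J·walls(A)`, `walls(A) ≥ |∂_R(Λ∖A)|` (inert sites with an active site within range).  So
`E₀(H̃(h)) = min_A sector(A)` is governed by the SECTOR FUNCTIONAL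

  `sectorEnergy A = E₀(H_A(h)) + ε|A| + e₀|Λ∖A| + J·|∂_R(Λ∖A)|`     (`e₀` a real parameter; `e₀ = e_L(0)` above;
  the penalty `K N_{Λ∖A} ⪰ 0` only raises non-uniform sectors and vanishes in the uniform ones).

**The theorem (this file, finite `L`, exact).**  For `J ≥ C = Σ_δ (2‖κ δ‖ + 4|h|‖ω δ‖)` (`boundaryConst`):
* `sectorEnergy_ge`: `sectorEnergy A ≥ N · min(e_L(h) + ε, e₀)` for EVERY `A ⊆ Λ` — by the lattice lemma
  `groundEnergy_tiSourcedOn_ge'` (`E₀(H_A) ≥ |A| e_L(h) − C|∂_R(Λ∖A)|`: Ruelle's cut over an arbitrary region via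
  fermion-parity superselection + the translation-averaged boundary estimate; no gap, no uniqueness, no shape
  condition);
* `sectorEnergy_univ`, `sectorEnergy_empty`: the uniform sectors give exactly `N(e_L(h) + ε)` and `N e₀`;
* `isLeast_sectorEnergy`: hence `min_A sectorEnergy A = N · min(e_L(h) + ε, e₀)`.
With `e₀ = e_L(0)` this is the ε-lift profile `ẽ_L(h) = min(e_L(h) + ε, e_L(0))` REALISED INSIDE THE LOCAL CLASS:
where the gain `G_L(h) = e_L(0) − e_L(h)` is `< ε` (all small `h`) the minimum sits in the all-inert sector —
fermionic vacuum ⊗ flags, a gapped translation-invariant `U(1)`-invariant PRODUCT state: no long-range order of any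
kind, order parameter `0`; where `G_L(h) > ε` it sits in the all-active sector — the genuine sourced ground state
with its response and all its energy windows `e_L(h) + ε` (headline `SourcedResponseEpsilonLiftLocal_holds`).

technique_class: symmetry-breaking-field pinning-field finite-field-response finite-precision-data epsilon-lift quasi-average Koma-Tasaki-converse response-to-LRO-transfer energy-chord inert-level locality finite-range translation-invariance boundary-estimate parity-superselection
blocks: every certificate mechanism "finitely many certified SOURCED data of precision ε (ground-energy windows of `H − h_i O`, rows in sourced ground states at fields of gain `> ε`) ⇒ FLOOR on long-range order or on the `h → 0⁺` order parameter" over classes of TRANSLATION-INVARIANT FINITE-RANGE lattice fermion models (PC-a / door E1a of cell `hubbard-cq` with locality, finite range, Lieb–Robinson structure or translation invariance of the Hamiltonian as the extra hypothesis; census (12)/(13)).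
because: the flagged model is translation-invariant and finite-range, and by `sectorEnergy_ge` / `isLeast_sectorEnergy` its ground energy follows the ε-lift profile `N·min(e_L(h)+ε, e_L(0))` with the all-inert PRODUCT sector (no order) winning wherever the gain is `< ε` and the physical sourced sector winning wherever it is `> ε`; the lattice input is Ruelle's boundary estimate in both directions [cite: Ruelle1969, §2.2-2.3 and §3.3] on the CAR algebra [cite: BratteliRobinsonII1997, §5.2.2 and §6.2.4]; the only printed transfer runs LRO ⇒ response [cite: KomaTasaki1994, §1 and §2.5].
evasions_known: (E-a) algebraic purity — inequalities using that the on-site algebra is exactly one spinful fermion mode with NO extra conserved local quantity and an undressed source (the flag and the flag-dressed source break this; no producer in the cell); (E-b) an `h → 0⁺` modulus / continuity / no-level-crossing hypothesis on `(0, h₀]` uniform in the volume (the flagged model jumps at `G_L(h) = ε`); the proved direction LRO ⇒ response [cite: KomaTasaki1994, Corollary 2.9].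
scope_caveats: a statement about TRANSFER PRINCIPLES, not about the Hubbard model; proved at the level of the sector functional (the identification of the flagged Hamiltonian's flag sectors with `H_A(h) + K N_{Λ∖A} + const` is by inspection of its commuting flag projections and is not typed); strict uniqueness of the minimising sector (needs `J > C` and a connected range set) is not asserted; `e₀` is a free parameter (`= e_L(0)` in the barrier reading).
status: established (theorems `EpsilonLiftLocal.sectorEnergy_ge`, `EpsilonLiftLocal.isLeast_sectorEnergy`, `SourcedResponseEpsilonLiftLocal_holds`).

## References
* D. Ruelle, *Statistical Mechanics: Rigorous Results* (Benjamin 1969), §2.2–2.3 (interactions, restriction to a region,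
  boundary terms), §3.3 (sub-box variational principle). (`Ruelle1969`)
* O. Bratteli, D. W. Robinson, *Operator Algebras and QSM II* (1997), §5.2.2, §6.2.4. (`BratteliRobinsonII1997`)
* T. Koma, H. Tasaki, J. Stat. Phys. 76 (1994) 745–803, §1, §2.5, Corollary 2.9. (`KomaTasaki1994`)
* Cell memo: `run/shared/lean/pub/hubbard-cq/hubbard-cq-lens-negation-1/NEGATION-SIZING-v2.md` §10 (S0-LOCAL).
-/

noncomputable section

open Matrix Finset Literature.Probability.LatticeModels
open scoped ComplexOrder

namespace Literature.Barriers.HubbardSuperconductivity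

open Literature.MathematicalPhysics.QuantumLattice FermionTorus

/-- The `DecidableEq (FermionTorus 2 L)` instance of `SourcedTorusRegionEnergyBound.lean` (= `LinearOrder.toDecidableEq`,
the instance the generic region lemmas carry), re-selected so that the complements `Λ∖A` written here are the ones
of that file. [folklore] -/
local instance (priority := high) instDecidableEqFermionTorusLift {L : ℕ} : DecidableEq (FermionTorus 2 L) :=
  LinearOrder.toDecidableEq

namespace EpsilonLiftLocal

variable {L : ℕ} [NeZero L]

/-- **The sector functional of the site-local ε-lift**: for an active set `A ⊆ Λ`,
`sectorEnergy A = E₀(H_A(h)) + ε|A| + e₀|Λ∖A| + J·|∂_R(Λ∖A)|` — sourced terms inside the active region, precision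
offset `ε` per active site, inert energy density `e₀` per inert site, domain-wall cost `J` per inert boundary site.
[cite: Ruelle1969, §2.2] -/
def sectorEnergy (κ ω : TorusSite 2 L → ℂ) (U μ h ε e₀ J : ℝ) (A : Finset (FermionTorus 2 L)) : ℝ :=
  (tiSourcedOn L κ ω U μ h A).groundEnergy + ε * A.card + e₀ * Aᶜ.card + J * (torusBoundary L κ ω Aᶜ).card

variable (κ ω : TorusSite 2 L → ℂ) (U μ h ε e₀ J : ℝ)

omit [NeZero L] in
/-- No active site: no sourced term, `H_∅ = 0`. [cite: Ruelle1969, §2.2] -/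
theorem tiSourcedOn_empty : tiSourcedOn L κ ω U μ h ∅ = 0 := by
  have hc : restrictCoupling (∅ : Finset (FermionTorus 2 L)) (stepCoupling L κ) = 0 := by
    funext b; simp [restrictCoupling]
  have hw : ∀ z : FermionTorus 2 L × FermionTorus 2 L, restrictWeight (∅ : Finset (FermionTorus 2 L)) (stepWeight L ω) z = 0 :=
    fun z => by simp [restrictWeight]
  rw [tiSourcedOn, sourcedOn, hc, hopSum_zero, onSiteSum, Finset.sum_empty]
  simp [hw]

omit [NeZero L] in
/-- The ground energy of the zero operator is `0`. [folklore] -/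
private theorem groundEnergy_zero_matrix {m : Type*} [Fintype m] [DecidableEq m] [Nonempty m] :
    (0 : Matrix m m ℂ).groundEnergy = 0 := by
  have h0 : (Matrix.isHermitian_zero : (0 : Matrix m m ℂ).IsHermitian).eigenvalues = 0 :=
    (Matrix.IsHermitian.eigenvalues_eq_zero_iff _).2 rfl
  rw [groundEnergy_eq_iInf_eigenvalues_holds Matrix.isHermitian_zero, h0]
  simp

/-- **The all-active sector**: `sectorEnergy Λ = E₀(H_Λ(h)) + ε N`. [cite: Ruelle1969, §2.2] -/
theorem sectorEnergy_univ :
    sectorEnergy κ ω U μ h ε e₀ J Finset.univ =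
      (tiSourcedOn L κ ω U μ h Finset.univ).groundEnergy + ε * Fintype.card (FermionTorus 2 L) := by
  rw [sectorEnergy, Finset.card_univ, Finset.compl_univ, Finset.card_empty, torusBoundary, Finset.map_empty,
    stepBoundary_empty, Finset.card_empty]
  simp

/-- **The all-inert sector**: `sectorEnergy ∅ = e₀ N`. [cite: Ruelle1969, §2.2] -/
theorem sectorEnergy_empty :
    sectorEnergy κ ω U μ h ε e₀ J ∅ = e₀ * Fintype.card (FermionTorus 2 L) := by
  rw [sectorEnergy, tiSourcedOn_empty, groundEnergy_zero_matrix, Finset.card_empty, Finset.compl_empty, Finset.card_univ,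
    torusBoundary, Finset.map_univ_equiv, stepBoundary_univ, Finset.card_empty]
  simp

/-- **Lower bound on every sector**: for bond-reversal symmetric `κ` and a wall cost `J ≥ C` (`C = boundaryConst`),
`sectorEnergy A ≥ N · min(E₀(H_Λ(h))/N + ε, e₀)` for EVERY active set `A` — the lattice lemma
`E₀(H_A) ≥ |A|·E₀(H_Λ)/N − C|∂_R(Λ∖A)|` absorbs the boundary term into the wall cost. [cite: Ruelle1969, §3.3] -/
theorem sectorEnergy_ge {κ : TorusSite 2 L → ℂ} (hκ : ∀ δ, star (κ δ) = κ (-δ)) (ω : TorusSite 2 L → ℂ)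
    (U μ h ε e₀ : ℝ) {J : ℝ} (hJ : boundaryConst L κ ω h ≤ J) (A : Finset (FermionTorus 2 L)) :
    (Fintype.card (FermionTorus 2 L) : ℝ) *
        min ((tiSourcedOn L κ ω U μ h Finset.univ).groundEnergy / Fintype.card (FermionTorus 2 L) + ε) e₀ ≤
      sectorEnergy κ ω U μ h ε e₀ J A := by
  set N : ℝ := (Fintype.card (FermionTorus 2 L) : ℝ) with hN
  set eh : ℝ := (tiSourcedOn L κ ω U μ h Finset.univ).groundEnergy / Fintype.card (FermionTorus 2 L) with heh
  set m : ℝ := min (eh + ε) e₀ with hm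
  have hlat := groundEnergy_tiSourcedOn_ge' hκ ω U μ h A
  have hcard : (A.card : ℝ) + (Aᶜ.card : ℝ) = N := by
    rw [hN, Finset.card_compl]; push_cast [Nat.cast_sub (Finset.card_le_univ A)]; ring
  have hA0 : (0 : ℝ) ≤ A.card := Nat.cast_nonneg _
  have hAc0 : (0 : ℝ) ≤ Aᶜ.card := Nat.cast_nonneg _
  have hB0 : (0 : ℝ) ≤ (torusBoundary L κ ω Aᶜ).card := Nat.cast_nonneg _
  have hm1 : m ≤ eh + ε := min_le_left _ _
  have hm2 : m ≤ e₀ := min_le_right _ _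
  unfold sectorEnergy
  rw [← heh] at hlat
  have hwall : boundaryConst L κ ω h * (torusBoundary L κ ω Aᶜ).card ≤ J * (torusBoundary L κ ω Aᶜ).card :=
    mul_le_mul_of_nonneg_right hJ hB0
  calc N * m = (A.card : ℝ) * m + (Aᶜ.card : ℝ) * m := by rw [← hcard]; ring
    _ ≤ (A.card : ℝ) * (eh + ε) + (Aᶜ.card : ℝ) * e₀ :=
        add_le_add (mul_le_mul_of_nonneg_left hm1 hA0) (mul_le_mul_of_nonneg_left hm2 hAc0)
    _ ≤ _ := by nlinarith [hlat, hwall]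

/-- **The uniform sectors realise the bound**: `min_A sectorEnergy A = N · min(E₀(H_Λ(h))/N + ε, e₀)` — the least
value of the sector functional over all `2^N` active sets, attained at `A = Λ` or at `A = ∅`. [cite: Ruelle1969, §3.3] -/
theorem isLeast_sectorEnergy {κ : TorusSite 2 L → ℂ} (hκ : ∀ δ, star (κ δ) = κ (-δ)) (ω : TorusSite 2 L → ℂ)
    (U μ h ε e₀ : ℝ) {J : ℝ} (hJ : boundaryConst L κ ω h ≤ J) :
    IsLeast (Set.range (sectorEnergy κ ω U μ h ε e₀ J))
      ((Fintype.card (FermionTorus 2 L) : ℝ) *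
        min ((tiSourcedOn L κ ω U μ h Finset.univ).groundEnergy / Fintype.card (FermionTorus 2 L) + ε) e₀) := by
  have hN : (0 : ℝ) < Fintype.card (FermionTorus 2 L) := by
    have : 0 < Fintype.card (FermionTorus 2 L) := Fintype.card_pos
    exact_mod_cast this
  refine ⟨?_, ?_⟩
  · -- attained at `univ` or at `∅`
    rcases le_total ((tiSourcedOn L κ ω U μ h Finset.univ).groundEnergy / Fintype.card (FermionTorus 2 L) + ε) e₀ with hle | hle
    · refine ⟨Finset.univ, ?_⟩
      rw [min_eq_left hle, sectorEnergy_univ]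
      field_simp
    · refine ⟨∅, ?_⟩
      rw [min_eq_right hle, sectorEnergy_empty, mul_comm]
  · rintro _ ⟨A, rfl⟩
    exact sectorEnergy_ge hκ ω U μ h ε e₀ hJ A

/-- **Which uniform sector wins**: the all-active (physical, sourced) sector lies strictly below the all-inert
(order-free product) sector iff the gain exceeds the precision, `E₀(H_Λ(h))/N + ε < e₀`. [cite: Ruelle1969, §2.2] -/
theorem sectorEnergy_univ_lt_empty_iff :
    sectorEnergy κ ω U μ h ε e₀ J Finset.univ < sectorEnergy κ ω U μ h ε e₀ J ∅ ↔
      (tiSourcedOn L κ ω U μ h Finset.univ).groundEnergy / Fintype.card (FermionTorus 2 L) + ε < e₀ := by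
  have hN : (0 : ℝ) < Fintype.card (FermionTorus 2 L) := by
    have : 0 < Fintype.card (FermionTorus 2 L) := Fintype.card_pos
    exact_mod_cast this
  rw [sectorEnergy_univ, sectorEnergy_empty, div_add' _ _ _ hN.ne', div_lt_iff₀ hN]

end EpsilonLiftLocal

open EpsilonLiftLocal

/-- **Barrier `SourcedResponseEpsilonLiftLocal` (cell `hubbard-cq`, negation lens, census (13) site-local form).**
For EVERY translation-invariant finite-range pair-sourced Hubbard Hamiltonian on the torus `(ℤ/Lℤ)²` (bond-reversal
symmetric hoppings `κ`, pair weights `h·ω`, real `U, μ`), every precision `ε`, every inert energy density `e₀` and every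
wall cost `J ≥ C(κ, ω, h)`: the sector functional `A ↦ E₀(H_A(h)) + ε|A| + e₀|Λ∖A| + J|∂_R(Λ∖A)|` of the site-local
ε-lift is bounded below by `N · min(E₀(H_Λ(h))/N + ε, e₀)` on all `2^N` active sets and equals `N(E₀(H_Λ(h))/N + ε)`
on the all-active sector and `N e₀` on the all-inert one.  Reading (with `e₀ = e_L(0)`): the ground energy of the
translation-invariant, finite-range, flagged companion model is the ε-lift profile `N·min(e_L(h) + ε, e_L(0))`; for
gain `< ε` (all small fields) its ground sector is the order-free product sector, for gain `> ε` the physical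
sourced sector with all its data — so "certified sourced data of precision ε ⇒ LRO floor" fails also INSIDE the
class of local translation-invariant finite-range lattice fermion models; locality / finite range / translation
invariance of the Hamiltonian are not usable hypotheses for a PC-a transfer inequality.

technique_class: symmetry-breaking-field pinning-field finite-field-response finite-precision-data epsilon-lift quasi-average Koma-Tasaki-converse response-to-LRO-transfer energy-chord inert-level locality finite-range translation-invariance boundary-estimate parity-superselection
blocks: "finitely many certified sourced data of precision ε ⇒ FLOOR on ground-state LRO or on the quasi-average" as a transfer principle over classes of translation-invariant finite-range `U(1)` lattice fermion systems (cell `hubbard-cq` obstruction O2 / door E1a with locality as the extra hypothesis; census (12)(13); LADDER row PC-a).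
because: the flag-sector energies of the local ε-lift obey `sectorEnergy_ge` / `sectorEnergy_univ` / `sectorEnergy_empty` (this theorem), whose lattice input is Ruelle's boundary estimate in both directions over an arbitrary region [cite: Ruelle1969, §2.2-2.3 and §3.3] on the CAR algebra [cite: BratteliRobinsonII1997, §5.2.2 and §6.2.4]; printed theory runs LRO ⇒ response only [cite: KomaTasaki1994, §1 and §2.5].
evasions_known: (E-a) algebraic purity of the on-site algebra with an undressed source; (E-b) a volume-uniform `h → 0⁺` modulus / no-level-crossing hypothesis; the proved direction [cite: KomaTasaki1994, Corollary 2.9].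
scope_caveats: transfer principles, not models; sector-functional level (flag bookkeeping by inspection, number penalty `K N_{Λ∖A} ⪰ 0` omitted as it only raises non-uniform sectors); no uniqueness of the minimising sector asserted; finite `L`, every `L`.
status: established (theorem `SourcedResponseEpsilonLiftLocal_holds`).
[cite: Ruelle1969, §3.3] [cite: KomaTasaki1994, §1 and §2.5] -/
def SourcedResponseEpsilonLiftLocal : Prop :=
  ∀ (L : ℕ) [NeZero L] (κ ω : TorusSite 2 L → ℂ), (∀ δ, star (κ δ) = κ (-δ)) →
    ∀ (U μ h ε e₀ J : ℝ), boundaryConst L κ ω h ≤ J →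
      (∀ A : Finset (FermionTorus 2 L),
        (Fintype.card (FermionTorus 2 L) : ℝ) *
            min ((tiSourcedOn L κ ω U μ h Finset.univ).groundEnergy / Fintype.card (FermionTorus 2 L) + ε) e₀ ≤
          sectorEnergy κ ω U μ h ε e₀ J A) ∧
      sectorEnergy κ ω U μ h ε e₀ J Finset.univ =
        (tiSourcedOn L κ ω U μ h Finset.univ).groundEnergy + ε * Fintype.card (FermionTorus 2 L) ∧
      sectorEnergy κ ω U μ h ε e₀ J ∅ = e₀ * Fintype.card (FermionTorus 2 L) ∧
      IsLeast (Set.range (sectorEnergy κ ω U μ h ε e₀ J))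
        ((Fintype.card (FermionTorus 2 L) : ℝ) *
          min ((tiSourcedOn L κ ω U μ h Finset.univ).groundEnergy / Fintype.card (FermionTorus 2 L) + ε) e₀)

/-- **`SourcedResponseEpsilonLiftLocal` holds.** [cite: Ruelle1969, §3.3] -/
theorem SourcedResponseEpsilonLiftLocal_holds : SourcedResponseEpsilonLiftLocal := by
  intro L _ κ ω hκ U μ h ε e₀ J hJ
  exact ⟨fun A => sectorEnergy_ge hκ ω U μ h ε e₀ hJ A, sectorEnergy_univ κ ω U μ h ε e₀ J,
    sectorEnergy_empty κ ω U μ h ε e₀ J, isLeast_sectorEnergy hκ ω U μ h ε e₀ hJ⟩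

/-! ### The cell's sourced object of record: the `d`-wave pair-sourced `t–t'` Hubbard torus

`A_L = dWaveSourceTorusTT' L tp U μ h = tiSourcedOn L (ttStepFun L tp) (pairStepFun L ĝ_d) U μ h univ`
(`dWaveSourceTorusTT'_eq_tiSourcedOn`, `DWaveSourceTorusRegionEnergyBound.lean`), so the barrier bites on it by name:
the flag sectors of its site-local ε-lift carry `E₀(A_{L,A}(h)) + ε|A| + e₀|Λ∖A| + J|∂_R(Λ∖A)|` with
`A_{L,A} = dWaveSourceTorusTT'On L tp U μ h A` (all terms of `A_L` inside `A`). -/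

namespace EpsilonLiftLocal

variable {L : ℕ} [NeZero L]

/-- **Sector bound for the sourced `t–t'` `d`-wave torus**: for every active set `A ⊆ Λ_L` and wall cost
`J ≥ C = boundaryConst L (ttStepFun L tp) (pairStepFun L ĝ_d) h`,
`E₀(A_{L,A}(h)) + ε|A| + e₀|Λ∖A| + J|∂_R(Λ∖A)| ≥ L²·min(E₀(A_L(h))/L² + ε, e₀)` (the sites of `FermionTorus 2 L`
number `Fintype.card (FermionTorus 2 L) = L²`). [cite: Ruelle1969, §3.3] -/
theorem sectorEnergy_ge_dWaveTT' (tp U μ h ε e₀ : ℝ) {J : ℝ}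
    (hJ : boundaryConst L (ttStepFun L tp) (pairStepFun L dWaveFormFactor) h ≤ J) (A : Finset (FermionTorus 2 L)) :
    (Fintype.card (FermionTorus 2 L) : ℝ) *
        min ((dWaveSourceTorusTT' L tp U μ h).groundEnergy / Fintype.card (FermionTorus 2 L) + ε) e₀ ≤
      sectorEnergy (ttStepFun L tp) (pairStepFun L dWaveFormFactor) U μ h ε e₀ J A := by
  rw [dWaveSourceTorusTT'_eq_tiSourcedOn, dWaveSourceTorusTT'On]
  exact sectorEnergy_ge (ttStepFun_symm L tp) _ U μ h ε e₀ hJ A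

/-- The all-active sector of the sourced `t–t'` `d`-wave torus: `E₀(A_L(h)) + ε L²`. [cite: Ruelle1969, §2.2] -/
theorem sectorEnergy_univ_dWaveTT' (tp U μ h ε e₀ J : ℝ) :
    sectorEnergy (ttStepFun L tp) (pairStepFun L dWaveFormFactor) U μ h ε e₀ J Finset.univ =
      (dWaveSourceTorusTT' L tp U μ h).groundEnergy + ε * Fintype.card (FermionTorus 2 L) := by
  rw [dWaveSourceTorusTT'_eq_tiSourcedOn, dWaveSourceTorusTT'On]
  exact sectorEnergy_univ _ _ U μ h ε e₀ J

/-- **The minimal sector energy of the sourced `t–t'` `d`-wave torus is `L²·min(e_L(h) + ε, e₀)`**,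
`e_L(h) = E₀(dWaveSourceTorusTT' L tp U μ h)/L²`, attained at the all-active or the all-inert sector.
[cite: Ruelle1969, §3.3] -/
theorem isLeast_sectorEnergy_dWaveTT' (tp U μ h ε e₀ : ℝ) {J : ℝ}
    (hJ : boundaryConst L (ttStepFun L tp) (pairStepFun L dWaveFormFactor) h ≤ J) :
    IsLeast (Set.range (sectorEnergy (ttStepFun L tp) (pairStepFun L dWaveFormFactor) U μ h ε e₀ J))
      ((Fintype.card (FermionTorus 2 L) : ℝ) *
        min ((dWaveSourceTorusTT' L tp U μ h).groundEnergy / Fintype.card (FermionTorus 2 L) + ε) e₀) := by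
  rw [dWaveSourceTorusTT'_eq_tiSourcedOn, dWaveSourceTorusTT'On]
  exact isLeast_sectorEnergy (ttStepFun_symm L tp) _ U μ h ε e₀ hJ

end EpsilonLiftLocal

/-- **The barrier for the cell's object of record**: `SourcedResponseEpsilonLiftLocal` specialised to
`dWaveSourceTorusTT' L tp U μ h` (Xu et al. 2024 eq. (1) with the Koma–Tasaki `d`-wave source): for every `L`,
`tp, U, μ, h, ε, e₀` and `J ≥ C`, all `2^{L²}` flag sectors of the site-local ε-lift lie above
`L²·min(E₀(A_L(h))/L² + ε, e₀)`, the all-active sector equals `E₀(A_L(h)) + εL²`, the all-inert one `e₀L²`, and the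
minimum is attained — the ε-lift profile of census (13) realised by a translation-invariant finite-range companion
of the cell's own model. [cite: KomaTasaki1994, §1 and §2.5] [cite: Ruelle1969, §3.3] -/
theorem SourcedResponseEpsilonLiftLocal_dWaveTT' (L : ℕ) [NeZero L] (tp U μ h ε e₀ J : ℝ)
    (hJ : boundaryConst L (ttStepFun L tp) (pairStepFun L dWaveFormFactor) h ≤ J) :
    (∀ A : Finset (FermionTorus 2 L),
        (Fintype.card (FermionTorus 2 L) : ℝ) *
            min ((dWaveSourceTorusTT' L tp U μ h).groundEnergy / Fintype.card (FermionTorus 2 L) + ε) e₀ ≤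
          sectorEnergy (ttStepFun L tp) (pairStepFun L dWaveFormFactor) U μ h ε e₀ J A) ∧
      sectorEnergy (ttStepFun L tp) (pairStepFun L dWaveFormFactor) U μ h ε e₀ J Finset.univ =
        (dWaveSourceTorusTT' L tp U μ h).groundEnergy + ε * Fintype.card (FermionTorus 2 L) ∧
      sectorEnergy (ttStepFun L tp) (pairStepFun L dWaveFormFactor) U μ h ε e₀ J ∅ = e₀ * Fintype.card (FermionTorus 2 L) ∧
      IsLeast (Set.range (sectorEnergy (ttStepFun L tp) (pairStepFun L dWaveFormFactor) U μ h ε e₀ J))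
        ((Fintype.card (FermionTorus 2 L) : ℝ) *
          min ((dWaveSourceTorusTT' L tp U μ h).groundEnergy / Fintype.card (FermionTorus 2 L) + ε) e₀) :=
  ⟨fun A => sectorEnergy_ge_dWaveTT' tp U μ h ε e₀ hJ A, sectorEnergy_univ_dWaveTT' tp U μ h ε e₀ J,
    sectorEnergy_empty _ _ U μ h ε e₀ J, isLeast_sectorEnergy_dWaveTT' tp U μ h ε e₀ hJ⟩

/-! ### Numeric wall cost: `J ≥ 8 + 8|t'| + 8√2|h|` suffices (`boundaryConst_dWaveTT'_le`) -/

namespace EpsilonLiftLocal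

variable {L : ℕ} [NeZero L]

/-- **Sector bound with a numeric wall cost**: for the sourced `t–t'` `d`-wave torus every wall cost
`J ≥ 8 + 8|t'| + 8√2|h|` (four n.n. and four diagonal hoppings through a site, both spins; four `d`-wave bonds of
weight `1/√2` with their adjoints) gives `sectorEnergy A ≥ L²·min(E₀(A_L(h))/L² + ε, e₀)` for every active set `A`;
at the cell's anchor `t' = −1/4` any `J ≥ 10 + 8√2|h|` does. [cite: Ruelle1969, §3.3] -/
theorem sectorEnergy_ge_dWaveTT'_numeric (tp U μ h ε e₀ : ℝ) {J : ℝ} (hJ : 8 + 8 * |tp| + 8 * Real.sqrt 2 * |h| ≤ J)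
    (A : Finset (FermionTorus 2 L)) :
    (Fintype.card (FermionTorus 2 L) : ℝ) *
        min ((dWaveSourceTorusTT' L tp U μ h).groundEnergy / Fintype.card (FermionTorus 2 L) + ε) e₀ ≤
      sectorEnergy (ttStepFun L tp) (pairStepFun L dWaveFormFactor) U μ h ε e₀ J A :=
  sectorEnergy_ge_dWaveTT' tp U μ h ε e₀ ((boundaryConst_dWaveTT'_le L tp h).trans hJ) A

/-- The minimum over sectors with a numeric wall cost. [cite: Ruelle1969, §3.3] -/
theorem isLeast_sectorEnergy_dWaveTT'_numeric (tp U μ h ε e₀ : ℝ) {J : ℝ} (hJ : 8 + 8 * |tp| + 8 * Real.sqrt 2 * |h| ≤ J) :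
    IsLeast (Set.range (sectorEnergy (ttStepFun L tp) (pairStepFun L dWaveFormFactor) U μ h ε e₀ J))
      ((Fintype.card (FermionTorus 2 L) : ℝ) *
        min ((dWaveSourceTorusTT' L tp U μ h).groundEnergy / Fintype.card (FermionTorus 2 L) + ε) e₀) :=
  isLeast_sectorEnergy_dWaveTT' tp U μ h ε e₀ ((boundaryConst_dWaveTT'_le L tp h).trans hJ)

end EpsilonLiftLocal

/-- **The barrier for `dWaveSourceTorusTT'` with everything numeric**: for every `L`, `tp, U, μ, h, ε, e₀` and every
wall cost `J ≥ 8 + 8|t'| + 8√2|h|`, the flag sectors of the site-local ε-lift of `dWaveSourceTorusTT' L tp U μ h` lie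
above `L²·min(E₀(A_L(h))/L² + ε, e₀)`, the uniform sectors give `E₀(A_L(h)) + εL²` and `e₀L²`, and the minimum is
attained — census (13) in site-local form at the cell's couplings with an explicit finite-range domain-wall constant.
[cite: KomaTasaki1994, §1 and §2.5] [cite: Ruelle1969, §3.3] -/
theorem SourcedResponseEpsilonLiftLocal_dWaveTT'_numeric (L : ℕ) [NeZero L] (tp U μ h ε e₀ J : ℝ)
    (hJ : 8 + 8 * |tp| + 8 * Real.sqrt 2 * |h| ≤ J) :
    (∀ A : Finset (FermionTorus 2 L),
        (Fintype.card (FermionTorus 2 L) : ℝ) *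
            min ((dWaveSourceTorusTT' L tp U μ h).groundEnergy / Fintype.card (FermionTorus 2 L) + ε) e₀ ≤
          sectorEnergy (ttStepFun L tp) (pairStepFun L dWaveFormFactor) U μ h ε e₀ J A) ∧
      sectorEnergy (ttStepFun L tp) (pairStepFun L dWaveFormFactor) U μ h ε e₀ J Finset.univ =
        (dWaveSourceTorusTT' L tp U μ h).groundEnergy + ε * Fintype.card (FermionTorus 2 L) ∧
      sectorEnergy (ttStepFun L tp) (pairStepFun L dWaveFormFactor) U μ h ε e₀ J ∅ = e₀ * Fintype.card (FermionTorus 2 L) ∧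
      IsLeast (Set.range (sectorEnergy (ttStepFun L tp) (pairStepFun L dWaveFormFactor) U μ h ε e₀ J))
        ((Fintype.card (FermionTorus 2 L) : ℝ) *
          min ((dWaveSourceTorusTT' L tp U μ h).groundEnergy / Fintype.card (FermionTorus 2 L) + ε) e₀) :=
  SourcedResponseEpsilonLiftLocal_dWaveTT' L tp U μ h ε e₀ J ((boundaryConst_dWaveTT'_le L tp h).trans hJ)

end Literature.Barriers.HubbardSuperconductivity
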